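import Mathlib.Analysis.Calculus.ContDiff.Basic
import Mathlib.Analysis.Calculus.ContDiff.Operations
import Mathlib.Analysis.SpecialFunctions.Pow.Real
import Mathlib.Analysis.Distribution.SchwartzSpace.Basic
import Mathlib.Analysis.Complex.Exponential
import Mathlib.Analysis.SpecificLimits.Basic
import Mathlib.Analysis.Fourier.FourierTransform
import Mathlib.Analysis.Distribution.SchwartzSpace.Fourier
import Mathlib.Analysis.InnerProductSpace.PiL2
import Mathlib.Analysis.Complex.OperatorNorm
import Mathlib.MeasureTheory.Measure.Haar.NormedSpace
import Literature.Probability.LatticeModels.TreeVolumeEffect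
import HarnessLib

/-!
# Single-scale kernels obtained by DILATION: derivative-and-decay bounds between the cubes of the unit lattice

Topic `Literature/Probability/LatticeModels` (cluster-expansion technology; companion of `TreeVolumeEffect.lean`
(the cube lattice `𝐃 ≅ ℤ^d`, `supDist`) and of `LinearAlgebra/PauliDeterminantSeveralCubes.lean`, whose hypotheses
it inhabits).  Filed by the `pub-balaban-gaps` cell (G3, seat mrs-lit-2, file 39).

A propagator of ONE momentum slice `i` is, up to bounded factors, a DILATE `C(x,y) = λ^a F(λ(x − y))` of a fixed
smooth profile `F` with `λ = M^i` (`γ^h` in Mastropietro's notation), and the printed single-scale bounds have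
the universal shape «`|g^{(h)}_ω(x − y)| ≤ γ^h C_N / (1 + (γ^h|x − y|^N))`» [sic] (Mastropietro 2008 (12.47)),
«`|∂^n Ω̄^{(h)}_{a,b}(x,y)| ≤ γ^{(2+n)h}|U| C_N / (1 + (γ^h|x − y|)^N)`» ((12.96)), «`|∂^m C^i(x,y)| ≤ K·M^{i(m+1)}
e^{−cM^i|x−y|}`» (Rivasseau 1991 (III.4.8)), «`|C(x,y)| ≤ O(1)(1/(1+|x−y|))^r`» ((III.1.6); «any summable decay», p.159 L1).
THIS file proves the elementary scaling facts behind that shape, in the form consumed by the Pauli-principle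
files (operator norms of Fréchet derivatives for the sup norm of `ℝ^d = (Fin d → ℝ)`, cubes of side `ℓ = λ⁻¹`
labelled by `ℤ^d`):

* `schwartz_profile_bound` — a Schwartz profile `F ∈ 𝓢(ℝ^d, ℝ)` HAS such bounds: for all `p k : ℕ` there is
  `B ≥ 0` with `‖DⁿF(u)‖ ≤ B(1 + ‖u‖)^{−k}` for `n ≤ p` (Mathlib's `SchwartzMap.one_add_le_sup_seminorm_apply`), so
  the chain Schwartz profile ⟹ this file ⟹ `PauliDeterminantSeveralCubes` is non-vacuous;
* `exp_neg_mul_le_rpow_neg`, `exp_profile_bound` — the EXPONENTIAL decay printed in (III.4.8) implies the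
  power-law decay of every order `k` (`e^{−cm} ≤ (k!e^c/c^k)(1+m)^{−k}`), so exponentially bounded profiles qualify too;
* `norm_iteratedFDeriv_dilate_le_of_weight` ∕ `norm_iteratedFDeriv_dilate_le` ∕ `norm_iteratedFDeriv_dilate_exp_le` —
  if `‖DⁿF(u)‖ ≤ B·w(‖u‖)` for `n ≤ p` (any weight `w`; power law `(1 + ·)^{−s}`; the exponential `e^{−c·}` printed in
  (III.4.8)), then the dilate `t ↦ λ^a F(λ(t − y))` has `‖Dⁿ‖ ≤ λ^a·B·λⁿ·w(λ‖t − y‖)` (chain rule with the linear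
  map `λ·id`, `ContinuousLinearMap.iteratedFDeriv_comp_right`);
* `supDist_le_inv_mul_norm_add_one`, `rpow_neg_one_add_dist_le_cubes`, `exp_neg_mul_dist_le_cubes` — for `t` in
  the cube `Δ` and `y` in the cube `Δ'` of the lattice `ℤ^d·ℓ`: `|Δ − Δ'|_∞ ≤ ℓ⁻¹‖t − y‖ + 1`, hence
  `(1 + ℓ⁻¹‖t − y‖)^{−s} ≤ 2^s (1 + |Δ − Δ'|_∞)^{−s}` and `e^{−cℓ⁻¹‖t − y‖} ≤ e^c e^{−c|Δ − Δ'|_∞}` (`supDist` of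
  `TreeVolumeEffect.lean`);
* `sum_exp_neg_mul_supDist_le` — `Σ_{y∈Λ} e^{−c|x−y|_∞} ≤ (2/(1 − e^{−c/d}))^d` uniformly in the finite `Λ ⊂ ℤ^d`:
  the exponential cube weight of (III.4.8) has bounded row sums, so it can serve directly as the `dec` of
  `PauliDeterminantSeveralCubes.abs_det_mul_sqrt_prod_factorial_pow_le_pi`;
* `fourier_comp_inv_smul` — the momentum side: `𝓕(p ↦ φ(λ⁻¹p))(x) = λ^{dim}·(𝓕φ)(λx)` on any finite-dimensional
  real inner product space, i.e. a momentum cutoff profile at scale `λ = M^i` IS a dilated position-space kernel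
  `λ^a F(λx)` with the fixed profile `F = 𝓕φ` (the massless case of [R] (III.4.6)–(III.4.7));
* `exists_profile_bound_re_fourier` — for a Schwartz momentum cutoff `φ ∈ 𝓢(ℝ^d, ℂ)` (Euclidean `ℝ^d`) the real
  position profile `F = Re(𝓕φ) ∘ e⁻¹` on `(Fin d → ℝ, ‖·‖_∞)` has, for all `p k`, `‖DⁿF(x)‖ ≤ B(1 + ‖x‖_∞)^{−k}`
  (`n ≤ p`) — Mathlib's Schwartz-space Fourier transform + `compCLMOfContinuousLinearEquiv`; so the whole chain
  momentum cutoff ⟹ dilated kernel ⟹ (III.4.8)-shaped bounds ⟹ Lemma III.4.1 is inhabited;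
* `norm_iteratedFDeriv_dilate_le_cubes` — hence `‖Dⁿ_t C(·,y)(t)‖ ≤ (2^s B λ^a)·(ℓ⁻¹)ⁿ·(1 + |Δ − Δ'|_∞)^{−s}`,
  which is EXACTLY the hypothesis shape of `PauliDeterminantSeveralCubes.abs_det_mul_prod_factorial_pow_le_zlattice`
  (with `K = 2^s B λ^a`), and `norm_iteratedFDeriv_dilate_le_cubes'` the same for the second variable
  (`x ↦ C(x, ·)`, via the profile `u ↦ F(−u)`); `norm_iteratedFDeriv_dilate_le_cubes_exp` ∕ `…_exp'` — the same with
  the EXPONENTIAL weight: `‖Dⁿ_t C(·,y)(t)‖ ≤ (e^c B λ^a)·(ℓ⁻¹)ⁿ·e^{−c|Δ − Δ'|_∞}`, the hypothesis `hK` of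
  `PauliDeterminantSeveralCubes.abs_det_mul_sqrt_prod_factorial_pow_le_pi` with `dec = e^{−c|Δ − Δ'|_∞}`.

HONEST FRAMING: elementary calculus (chain rule under dilation and translation) and the geometry of cubes; NO
propagator of [R] ∕ MRS ∕ Mastropietro is constructed here — the profile `F` and its decay are hypotheses; the
exponential decay of (III.4.8) is not used (polynomial decay suffices downstream).  No definition, no named fact
(D-0026 net debt 0).  Nothing continuum, nothing Clay.

## References

* [Mastropietro2008] V. Mastropietro, *Non-Perturbative Renormalization*, World Scientific 2008, (12.47) p.183
  L18 and (12.96) p.189 L19 of the held copy (single-scale propagator bounds).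
* [Rivasseau1991] V. Rivasseau, *From Perturbative to Constructive Renormalization*, Princeton 1991, §III.1
  (III.1.5)–(III.1.6) p.149, Theorem III.1.2 p.159 («summable decay», «any summable decay» p.159 L1), §III.4
  (III.4.8) p.245.
-/

namespace Literature.Probability.LatticeModels

namespace ScaledKernel

open Set Literature.Probability.LatticeModels.VolumeEffect.ZLattice

variable {d : ℕ}

/-- **A Schwartz profile has the required derivative decay**: for `F ∈ 𝓢(ℝ^d, ℝ)` and `p k : ℕ` there is
`B ≥ 0` with `‖DⁿF(u)‖ ≤ B (1 + ‖u‖)^{−k}` for all `n ≤ p` and all `u` (a finite supremum of Schwartz seminorms;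
the smooth momentum cutoffs of one slice have Schwartz Fourier transforms: «C(x,y) which has good decrease at
infinity … power-law with a very large (adjustable) power rate r»). [cite: Rivasseau1991, §III.1 (III.1.5)–(III.1.6) p.149] -/
theorem schwartz_profile_bound (F : SchwartzMap (Fin d → ℝ) ℝ) (p k : ℕ) :
    ∃ B : ℝ, 0 ≤ B ∧ ∀ n, n ≤ p → ∀ u, ‖iteratedFDeriv ℝ n F u‖ ≤ B * (1 + ‖u‖) ^ (-(k : ℝ)) := by
  refine ⟨2 ^ k * (Finset.Iic (k, p)).sup (fun m => SchwartzMap.seminorm ℝ m.1 m.2) F, by positivity,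
    fun n hn u => ?_⟩
  have h := SchwartzMap.one_add_le_sup_seminorm_apply (𝕜 := ℝ) (m := (k, p)) le_rfl hn F u
  have hpos : 0 < (1 + ‖u‖) := by positivity
  rw [Real.rpow_neg hpos.le, Real.rpow_natCast, ← div_eq_mul_inv, le_div_iff₀ (pow_pos hpos k), mul_comm]
  exact h

/-- **Exponential decay is summable decay of every order**: for `c > 0`, `k : ℕ` and `m ≥ 0`,
`e^{−cm} ≤ (k!·e^c/c^k)·(1 + m)^{−k}` (from `x^k/k! ≤ e^x` at `x = c(1+m)`).  So the EXPONENTIAL decay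
«`|∂^m C^i(x,y)| ≤ K·M^{i(m+1)} e^{−cM^i|x−y|}`» printed in (III.4.8) implies the power-law decay (III.1.6) of any
order used downstream («Theorem III.1.1 also holds under the assumption (III.1.6) provided only that r > d (summable
decay)»). [cite: Rivasseau1991, §III.4 (III.4.8) p.245; §III.1 Theorem III.1.2 p.159] -/
theorem exp_neg_mul_le_rpow_neg {c : ℝ} (hc : 0 < c) (k : ℕ) {m : ℝ} (hm : 0 ≤ m) :
    Real.exp (-(c * m)) ≤ ((k.factorial : ℝ) * Real.exp c / c ^ k) * (1 + m) ^ (-(k : ℝ)) := by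
  have h1m : 0 < 1 + m := by positivity
  have hx : 0 ≤ c * (1 + m) := by positivity
  have hck : 0 < c ^ k := pow_pos hc k
  have hfk : (0 : ℝ) < k.factorial := by positivity
  have h := Real.pow_div_factorial_le_exp (x := c * (1 + m)) hx k
  -- (c(1+m))^k / k! ≤ e^{c(1+m)} = e^c · e^{cm}
  rw [div_le_iff₀ hfk] at h
  have hexp' : Real.exp (c * (1 + m)) = Real.exp c * Real.exp (c * m) := by
    rw [← Real.exp_add]; ring_nf
  have hpow : (c * (1 + m)) ^ k = c ^ k * (1 + m) ^ k := mul_pow _ _ _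
  rw [hexp', hpow] at h
  rw [Real.rpow_neg h1m.le, Real.rpow_natCast]
  -- goal: e^{-cm} ≤ (k! e^c / c^k) (1+m)^{-k}  ⟺  e^{-cm} (1+m)^k c^k ≤ k! e^c
  have hmain : Real.exp (-(c * m)) * ((1 + m) ^ k * c ^ k) ≤ (k.factorial : ℝ) * Real.exp c := by
    have hexp : Real.exp (-(c * m)) * Real.exp (c * m) = 1 := by rw [← Real.exp_add]; simp
    calc Real.exp (-(c * m)) * ((1 + m) ^ k * c ^ k) = Real.exp (-(c * m)) * (c ^ k * (1 + m) ^ k) := by ring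
      _ ≤ Real.exp (-(c * m)) * (Real.exp c * Real.exp (c * m) * k.factorial) :=
          mul_le_mul_of_nonneg_left h (Real.exp_pos _).le
      _ = (k.factorial : ℝ) * Real.exp c * (Real.exp (-(c * m)) * Real.exp (c * m)) := by ring
      _ = (k.factorial : ℝ) * Real.exp c := by rw [hexp, mul_one]
  calc Real.exp (-(c * m)) = Real.exp (-(c * m)) * ((1 + m) ^ k * c ^ k) * (c ^ k)⁻¹ * ((1 + m) ^ k)⁻¹ := by
        field_simp
    _ ≤ (k.factorial : ℝ) * Real.exp c * (c ^ k)⁻¹ * ((1 + m) ^ k)⁻¹ := by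
        gcongr
    _ = (k.factorial : ℝ) * Real.exp c / c ^ k * ((1 + m) ^ k)⁻¹ := by ring

/-- **A profile with exponentially decaying derivatives has the required power-law bounds** (every order `k`):
`‖DⁿF(u)‖ ≤ B e^{−c‖u‖}` for `n ≤ p` ⟹ `‖DⁿF(u)‖ ≤ (B·k!·e^c/c^k)(1 + ‖u‖)^{−k}` — the (III.4.8) ⟹ (III.1.6) step
for the profile of a sliced propagator. [cite: Rivasseau1991, §III.4 (III.4.8) p.245; §III.1 (III.1.6) p.149] -/
theorem exp_profile_bound {p : ℕ} (F : (Fin d → ℝ) → ℝ) {B c : ℝ} (hB : 0 ≤ B) (hc : 0 < c)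
    (hF : ∀ n, n ≤ p → ∀ u, ‖iteratedFDeriv ℝ n F u‖ ≤ B * Real.exp (-(c * ‖u‖))) (k : ℕ) :
    ∀ n, n ≤ p → ∀ u, ‖iteratedFDeriv ℝ n F u‖ ≤
      (B * ((k.factorial : ℝ) * Real.exp c / c ^ k)) * (1 + ‖u‖) ^ (-(k : ℝ)) := by
  intro n hn u
  have h := exp_neg_mul_le_rpow_neg hc k (norm_nonneg u)
  calc ‖iteratedFDeriv ℝ n F u‖ ≤ B * Real.exp (-(c * ‖u‖)) := hF n hn u
    _ ≤ B * (((k.factorial : ℝ) * Real.exp c / c ^ k) * (1 + ‖u‖) ^ (-(k : ℝ))) :=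
        mul_le_mul_of_nonneg_left h hB
    _ = (B * ((k.factorial : ℝ) * Real.exp c / c ^ k)) * (1 + ‖u‖) ^ (-(k : ℝ)) := by ring

/-- **Derivatives of a dilated, translated profile — any radial weight.**  If `F : ℝ^d → ℝ` is `C^p` with
`‖DⁿF(u)‖ ≤ B·w(‖u‖)` for `n ≤ p` and some weight `w`, then for `λ > 0` the single-scale kernel
`t ↦ λ^a F(λ(t − y))` satisfies `‖Dⁿ(t ↦ λ^a F(λ(t − y)))(t)‖ ≤ λ^a B λⁿ w(λ‖t − y‖)` (chain rule with the linear
map `λ·id`, translation invariance). [cite: Mastropietro2008, (12.96) p.189; (12.47) p.183] -/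
theorem norm_iteratedFDeriv_dilate_le_of_weight {p : ℕ} (F : (Fin d → ℝ) → ℝ) (hF : ContDiff ℝ p F) {B : ℝ}
    (w : ℝ → ℝ) (hB : ∀ n, n ≤ p → ∀ u, ‖iteratedFDeriv ℝ n F u‖ ≤ B * w ‖u‖)
    {lam : ℝ} (hlam : 0 < lam) (a : ℝ) (y : Fin d → ℝ) {n : ℕ} (hn : n ≤ p) (t : Fin d → ℝ) :
    ‖iteratedFDeriv ℝ n (fun t : Fin d → ℝ => lam ^ a * F (lam • (t - y))) t‖ ≤
      lam ^ a * B * lam ^ n * w (lam * ‖t - y‖) := by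
  -- the affine change of variables `t ↦ λ(t − y)` = (λ·id) ∘ (· − y)
  set L : (Fin d → ℝ) →L[ℝ] (Fin d → ℝ) := lam • ContinuousLinearMap.id ℝ (Fin d → ℝ) with hL
  have hLapply : ∀ v, L v = lam • v := fun v => by simp [hL]
  have hLnorm : ‖L‖ ≤ lam := by
    refine ContinuousLinearMap.opNorm_le_bound _ hlam.le fun v => ?_
    rw [hLapply, norm_smul, Real.norm_eq_abs, abs_of_pos hlam]
  -- F ∘ L has n-th derivative (DⁿF (L u)).compContinuousLinearMap L
  have hcomp : ∀ u, iteratedFDeriv ℝ n (F ∘ L) u =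
      (iteratedFDeriv ℝ n F (L u)).compContinuousLinearMap fun _ => L :=
    fun u => L.iteratedFDeriv_comp_right hF u (by exact_mod_cast hn)
  have hnormcomp : ∀ u, ‖iteratedFDeriv ℝ n (F ∘ L) u‖ ≤ ‖iteratedFDeriv ℝ n F (L u)‖ * lam ^ n := by
    intro u
    rw [hcomp u]
    refine (ContinuousMultilinearMap.norm_compContinuousLinearMap_le _ _).trans ?_
    refine mul_le_mul_of_nonneg_left ?_ (norm_nonneg _)
    rw [Finset.prod_const, Finset.card_univ, Fintype.card_fin]
    exact pow_le_pow_left₀ (norm_nonneg _) hLnorm n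
  -- translation: G := (F ∘ L) (· − y)
  have htrans : iteratedFDeriv ℝ n (fun t => (F ∘ L) (t - y)) t = iteratedFDeriv ℝ n (F ∘ L) (t - y) := by
    rw [iteratedFDeriv_comp_sub]
  -- the scalar factor
  have hFL : ContDiff ℝ p (fun t : Fin d → ℝ => (F ∘ L) (t - y)) :=
    (hF.comp L.contDiff).comp (contDiff_id.sub contDiff_const)
  have hsmul : iteratedFDeriv ℝ n (fun t : Fin d → ℝ => lam ^ a * F (lam • (t - y))) t =
      lam ^ a • iteratedFDeriv ℝ n (fun t => (F ∘ L) (t - y)) t := by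
    have hfun : (fun t : Fin d → ℝ => lam ^ a * F (lam • (t - y))) =
        fun t => lam ^ a • (fun t => (F ∘ L) (t - y)) t := by
      funext t; simp [hLapply, smul_eq_mul]
    rw [hfun]
    exact iteratedFDeriv_const_smul_apply' (hFL.of_le (by exact_mod_cast hn)).contDiffAt
  rw [hsmul, norm_smul, htrans, Real.norm_eq_abs, abs_of_pos (Real.rpow_pos_of_pos hlam a)]
  have h1 := hnormcomp (t - y)
  have h2 := hB n hn (L (t - y))
  rw [hLapply, norm_smul, Real.norm_eq_abs, abs_of_pos hlam] at h2
  have hla : 0 ≤ lam ^ a := (Real.rpow_pos_of_pos hlam a).le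
  calc lam ^ a * ‖iteratedFDeriv ℝ n (F ∘ L) (t - y)‖
      ≤ lam ^ a * (B * w (lam * ‖t - y‖) * lam ^ n) := by
        refine mul_le_mul_of_nonneg_left (h1.trans ?_) hla
        exact mul_le_mul_of_nonneg_right h2 (pow_nonneg hlam.le _)
    _ = lam ^ a * B * lam ^ n * w (lam * ‖t - y‖) := by ring

/-- **Derivatives of a dilated, translated profile, power-law weight.**  If `F : ℝ^d → ℝ` is `C^p` with
`‖DⁿF(u)‖ ≤ B (1 + ‖u‖)^{−s}` for `n ≤ p`, then for `λ > 0` the single-scale kernel `t ↦ λ^a F(λ(t − y))` satisfies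
`‖Dⁿ(t ↦ λ^a F(λ(t − y)))(t)‖ ≤ λ^a B λⁿ (1 + λ‖t − y‖)^{−s}` — the shape `γ^{(2+n)h} C_N/(1 + (γ^h|x − y|)^N)` of the
single-scale bounds. [cite: Mastropietro2008, (12.96) p.189; (12.47) p.183] -/
theorem norm_iteratedFDeriv_dilate_le {p : ℕ} (F : (Fin d → ℝ) → ℝ) (hF : ContDiff ℝ p F) {B s : ℝ}
    (hB : ∀ n, n ≤ p → ∀ u, ‖iteratedFDeriv ℝ n F u‖ ≤ B * (1 + ‖u‖) ^ (-s))
    {lam : ℝ} (hlam : 0 < lam) (a : ℝ) (y : Fin d → ℝ) {n : ℕ} (hn : n ≤ p) (t : Fin d → ℝ) :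
    ‖iteratedFDeriv ℝ n (fun t : Fin d → ℝ => lam ^ a * F (lam • (t - y))) t‖ ≤
      lam ^ a * B * lam ^ n * (1 + lam * ‖t - y‖) ^ (-s) :=
  norm_iteratedFDeriv_dilate_le_of_weight F hF (fun m => (1 + m) ^ (-s)) hB hlam a y hn t

/-- **Derivatives of a dilated, translated profile, EXPONENTIAL weight** — the decay actually printed in
(III.4.8): `‖DⁿF(u)‖ ≤ B e^{−c‖u‖}` for `n ≤ p` ⟹ `‖Dⁿ(t ↦ λ^a F(λ(t − y)))(t)‖ ≤ λ^a B λⁿ e^{−cλ‖t − y‖}`, i.e.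
«`|∂^m C^i(x,y)| ≤ K·M^{i(m+1)} e^{−cM^i|x−y|}`» with `λ = M^i`, `K = λ^{a−1}B` . [cite: Rivasseau1991, §III.4 (III.4.8) p.245] -/
theorem norm_iteratedFDeriv_dilate_exp_le {p : ℕ} (F : (Fin d → ℝ) → ℝ) (hF : ContDiff ℝ p F) {B c : ℝ}
    (hB : ∀ n, n ≤ p → ∀ u, ‖iteratedFDeriv ℝ n F u‖ ≤ B * Real.exp (-(c * ‖u‖)))
    {lam : ℝ} (hlam : 0 < lam) (a : ℝ) (y : Fin d → ℝ) {n : ℕ} (hn : n ≤ p) (t : Fin d → ℝ) :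
    ‖iteratedFDeriv ℝ n (fun t : Fin d → ℝ => lam ^ a * F (lam • (t - y))) t‖ ≤
      lam ^ a * B * lam ^ n * Real.exp (-(c * (lam * ‖t - y‖))) :=
  norm_iteratedFDeriv_dilate_le_of_weight F hF (fun m => Real.exp (-(c * m))) hB hlam a y hn t

/-- **Cube geometry**: for `t` in the cube `Δ` and `y` in the cube `Δ'` of the lattice `ℤ^d·ℓ` of side `ℓ`, the
sup-distance of the labels is at most `ℓ⁻¹‖t − y‖_∞ + 1`. [cite: Rivasseau1991, §III.4 p.245 L9 («the lattice of cubes with side size M^{−i}»)] -/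
theorem supDist_le_inv_mul_norm_add_one {ℓ : ℝ} (hℓ : 0 < ℓ) (Δ Δ' : Fin d → ℤ) {t y : Fin d → ℝ}
    (ht : ∀ μ, t μ ∈ Icc (ℓ * (Δ μ : ℝ)) (ℓ * (Δ μ : ℝ) + ℓ))
    (hy : ∀ μ, y μ ∈ Icc (ℓ * (Δ' μ : ℝ)) (ℓ * (Δ' μ : ℝ) + ℓ)) :
    supDist d Δ Δ' ≤ ℓ⁻¹ * ‖t - y‖ + 1 := by
  -- the sup-distance of the labels is at most ℓ⁻¹‖t − y‖ + 1
  have hcoord : ∀ μ, ((Δ μ - Δ' μ).natAbs : ℝ) ≤ ℓ⁻¹ * ‖t - y‖ + 1 := by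
    intro μ
    have h1 : |t μ - y μ| ≤ ‖t - y‖ := by
      rw [← Real.norm_eq_abs]; exact norm_le_pi_norm (t - y) μ
    have h2 : ℓ * (|((Δ μ : ℝ)) - (Δ' μ : ℝ)| - 1) ≤ |t μ - y μ| := by
      rcases le_total ((Δ μ : ℝ)) (Δ' μ : ℝ) with hle | hle
      · rw [abs_of_nonpos (sub_nonpos.2 hle)]
        have := (ht μ).2; have := (hy μ).1
        rw [abs_sub_comm]
        calc ℓ * (-(((Δ μ : ℝ)) - (Δ' μ : ℝ)) - 1) = ℓ * (Δ' μ : ℝ) - (ℓ * (Δ μ : ℝ) + ℓ) := by ring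
          _ ≤ y μ - t μ := by linarith
          _ ≤ |y μ - t μ| := le_abs_self _
      · rw [abs_of_nonneg (sub_nonneg.2 hle)]
        have := (ht μ).1; have := (hy μ).2
        calc ℓ * (((Δ μ : ℝ)) - (Δ' μ : ℝ) - 1) = ℓ * (Δ μ : ℝ) - (ℓ * (Δ' μ : ℝ) + ℓ) := by ring
          _ ≤ t μ - y μ := by linarith
          _ ≤ |t μ - y μ| := le_abs_self _
    have h3 : (((Δ μ - Δ' μ).natAbs : ℝ)) = |((Δ μ : ℝ)) - (Δ' μ : ℝ)| := by
      rw [Nat.cast_natAbs, Int.cast_abs, Int.cast_sub]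
    rw [h3]
    have h4 : ℓ * (|((Δ μ : ℝ)) - (Δ' μ : ℝ)| - 1) ≤ ‖t - y‖ := h2.trans h1
    have h5 : |((Δ μ : ℝ)) - (Δ' μ : ℝ)| - 1 ≤ ℓ⁻¹ * ‖t - y‖ := by
      rw [le_inv_mul_iff₀ hℓ]; exact h4
    linarith
  have hsup : supDist d Δ Δ' ≤ ℓ⁻¹ * ‖t - y‖ + 1 := by
    unfold supDist
    have : (Finset.univ.sup fun k => (Δ k - Δ' k).natAbs) ≤ ⌊ℓ⁻¹ * ‖t - y‖ + 1⌋₊ := by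
      refine Finset.sup_le fun μ _ => ?_
      exact Nat.le_floor (hcoord μ)
    calc ((Finset.univ.sup fun k => (Δ k - Δ' k).natAbs : ℕ) : ℝ) ≤ ⌊ℓ⁻¹ * ‖t - y‖ + 1⌋₊ := by
          exact_mod_cast this
      _ ≤ ℓ⁻¹ * ‖t - y‖ + 1 := Nat.floor_le (by positivity)
  exact hsup

/-- **Cube geometry**: for `t` in the cube `Δ` and `y` in the cube `Δ'` of the lattice `ℤ^d·ℓ` of side `ℓ`,
`1 + ℓ⁻¹‖t − y‖_∞ ≥ (1 + |Δ − Δ'|_∞)/2`, hence `(1 + ℓ⁻¹‖t − y‖)^{−s} ≤ 2^s (1 + |Δ − Δ'|_∞)^{−s}` (the decay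
of a slice-`i` propagator between points becomes a decay between the cubes of `𝐃^i`, «the lattice of cubes with
side size M^{−i}»). [cite: Rivasseau1991, §III.4 (III.4.8) p.245; §III.1 (III.1.6) p.149] -/
theorem rpow_neg_one_add_dist_le_cubes {s ℓ : ℝ} (hs : 0 ≤ s) (hℓ : 0 < ℓ) (Δ Δ' : Fin d → ℤ)
    {t y : Fin d → ℝ} (ht : ∀ μ, t μ ∈ Icc (ℓ * (Δ μ : ℝ)) (ℓ * (Δ μ : ℝ) + ℓ))
    (hy : ∀ μ, y μ ∈ Icc (ℓ * (Δ' μ : ℝ)) (ℓ * (Δ' μ : ℝ) + ℓ)) :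
    (1 + ℓ⁻¹ * ‖t - y‖) ^ (-s) ≤ (2 : ℝ) ^ s * (1 + supDist d Δ Δ') ^ (-s) := by
  have hsup := supDist_le_inv_mul_norm_add_one (d := d) hℓ Δ Δ' ht hy
  have hnn : 0 ≤ ℓ⁻¹ * ‖t - y‖ := by positivity
  have hsd0 : 0 ≤ supDist d Δ Δ' := Nat.cast_nonneg _
  have hkey : (1 + supDist d Δ Δ') / 2 ≤ 1 + ℓ⁻¹ * ‖t - y‖ := by linarith
  calc (1 + ℓ⁻¹ * ‖t - y‖) ^ (-s) ≤ ((1 + supDist d Δ Δ') / 2) ^ (-s) :=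
        Real.rpow_le_rpow_of_nonpos (by positivity) hkey (by linarith)
    _ = (2 : ℝ) ^ s * (1 + supDist d Δ Δ') ^ (-s) := by
        rw [Real.div_rpow (by positivity) zero_le_two, Real.rpow_neg zero_le_two, div_eq_mul_inv, inv_inv,
          mul_comm]

/-- **The hypothesis shape of the Pauli-principle bound, inhabited by dilated profiles** (first variable): for
`C(t,y) = λ^a F(λ(t − y))` with `‖DⁿF(u)‖ ≤ B(1+‖u‖)^{−s}` (`n ≤ p`), cubes of side `ℓ = λ⁻¹` labelled by `ℤ^d`,
`t ∈ Δ`, `y ∈ Δ'`:  `‖Dⁿ_t C(·,y)(t)‖ ≤ (2^s B λ^a) · (ℓ⁻¹)ⁿ · (1 + |Δ − Δ'|_∞)^{−s}` — exactly the hypothesis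
`hKx` of `PauliDeterminant.abs_det_mul_prod_factorial_pow_le_zlattice` with `K = 2^s B λ^a`.
[cite: Rivasseau1991, §III.4 (III.4.8) p.245; Mastropietro2008, (12.96) p.189] -/
theorem norm_iteratedFDeriv_dilate_le_cubes {p : ℕ} (F : (Fin d → ℝ) → ℝ) (hF : ContDiff ℝ p F)
    {B s : ℝ} (hs : 0 ≤ s) (hBnn : 0 ≤ B) (hB : ∀ n, n ≤ p → ∀ u, ‖iteratedFDeriv ℝ n F u‖ ≤ B * (1 + ‖u‖) ^ (-s))
    {ℓ : ℝ} (hℓ : 0 < ℓ) (a : ℝ) (Δ Δ' : Fin d → ℤ) {y : Fin d → ℝ}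
    (hy : ∀ μ, y μ ∈ Icc (ℓ * (Δ' μ : ℝ)) (ℓ * (Δ' μ : ℝ) + ℓ)) {n : ℕ} (hn : n ≤ p) {t : Fin d → ℝ}
    (ht : ∀ μ, t μ ∈ Icc (ℓ * (Δ μ : ℝ)) (ℓ * (Δ μ : ℝ) + ℓ)) :
    ‖iteratedFDeriv ℝ n (fun t : Fin d → ℝ => ℓ⁻¹ ^ a * F (ℓ⁻¹ • (t - y))) t‖ ≤
      (2 : ℝ) ^ s * B * ℓ⁻¹ ^ a * ℓ⁻¹ ^ n * (1 + supDist d Δ Δ') ^ (-s) := by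
  have hlam : 0 < ℓ⁻¹ := inv_pos.2 hℓ
  have h1 := norm_iteratedFDeriv_dilate_le F hF hB hlam a y hn t
  have h2 := rpow_neg_one_add_dist_le_cubes (d := d) hs hℓ Δ Δ' ht hy
  have hla : 0 ≤ ℓ⁻¹ ^ a := (Real.rpow_pos_of_pos hlam a).le
  calc ‖iteratedFDeriv ℝ n (fun t : Fin d → ℝ => ℓ⁻¹ ^ a * F (ℓ⁻¹ • (t - y))) t‖
      ≤ ℓ⁻¹ ^ a * B * ℓ⁻¹ ^ n * (1 + ℓ⁻¹ * ‖t - y‖) ^ (-s) := h1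
    _ ≤ ℓ⁻¹ ^ a * B * ℓ⁻¹ ^ n * ((2 : ℝ) ^ s * (1 + supDist d Δ Δ') ^ (-s)) :=
        mul_le_mul_of_nonneg_left h2 (by positivity)
    _ = (2 : ℝ) ^ s * B * ℓ⁻¹ ^ a * ℓ⁻¹ ^ n * (1 + supDist d Δ Δ') ^ (-s) := by ring

/-- The same for the SECOND variable: `x ↦ C(x₀, x) = λ^a F(λ(x₀ − x))` is the dilate of the reflected profile
`u ↦ F(−u)`, whose derivatives have the same norms; so `‖Dⁿ_x C(x₀,·)(x)‖ ≤ (2^s B λ^a)(ℓ⁻¹)ⁿ(1 + |Δ − Δ'|_∞)^{−s}` for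
`x ∈ Δ`, `x₀ ∈ Δ'` — the hypothesis `hKy` of the Pauli-principle bound.
[cite: Rivasseau1991, §III.4 (III.4.8) p.245; Mastropietro2008, (12.96) p.189] -/
theorem norm_iteratedFDeriv_dilate_le_cubes' {p : ℕ} (F : (Fin d → ℝ) → ℝ) (hF : ContDiff ℝ p F)
    {B s : ℝ} (hs : 0 ≤ s) (hBnn : 0 ≤ B) (hB : ∀ n, n ≤ p → ∀ u, ‖iteratedFDeriv ℝ n F u‖ ≤ B * (1 + ‖u‖) ^ (-s))
    {ℓ : ℝ} (hℓ : 0 < ℓ) (a : ℝ) (Δ Δ' : Fin d → ℤ) {x₀ : Fin d → ℝ}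
    (hx₀ : ∀ μ, x₀ μ ∈ Icc (ℓ * (Δ' μ : ℝ)) (ℓ * (Δ' μ : ℝ) + ℓ)) {n : ℕ} (hn : n ≤ p) {x : Fin d → ℝ}
    (hx : ∀ μ, x μ ∈ Icc (ℓ * (Δ μ : ℝ)) (ℓ * (Δ μ : ℝ) + ℓ)) :
    ‖iteratedFDeriv ℝ n (fun x : Fin d → ℝ => ℓ⁻¹ ^ a * F (ℓ⁻¹ • (x₀ - x))) x‖ ≤
      (2 : ℝ) ^ s * B * ℓ⁻¹ ^ a * ℓ⁻¹ ^ n * (1 + supDist d Δ Δ') ^ (-s) := by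
  -- reflected profile
  set G : (Fin d → ℝ) → ℝ := fun u => F (-u) with hG
  have hGdef : G = F ∘ (LinearIsometryEquiv.neg ℝ (E := Fin d → ℝ)) := by
    funext u; simp [hG]
  have hGc : ContDiff ℝ p G := by rw [hGdef]; exact hF.comp (LinearIsometryEquiv.neg ℝ).contDiff
  have hGB : ∀ m, m ≤ p → ∀ u, ‖iteratedFDeriv ℝ m G u‖ ≤ B * (1 + ‖u‖) ^ (-s) := by
    intro m hm u
    rw [hGdef, LinearIsometryEquiv.norm_iteratedFDeriv_comp_right]
    have h := hB m hm ((LinearIsometryEquiv.neg ℝ (E := Fin d → ℝ)) u)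
    simpa [norm_neg] using h
  have hfun : (fun x : Fin d → ℝ => ℓ⁻¹ ^ a * F (ℓ⁻¹ • (x₀ - x))) =
      fun x => ℓ⁻¹ ^ a * G (ℓ⁻¹ • (x - x₀)) := by
    funext x; simp only [hG, ← smul_neg, neg_sub]
  rw [hfun]
  exact norm_iteratedFDeriv_dilate_le_cubes G hGc hs hBnn hGB hℓ a Δ Δ' hx₀ hn hx

/-- **Cube geometry, exponential form**: for `t ∈ Δ`, `y ∈ Δ'` (cubes of side `ℓ` of `ℤ^d·ℓ`) and `c ≥ 0`,
`e^{−cℓ⁻¹‖t − y‖} ≤ e^{c}·e^{−c|Δ − Δ'|_∞}` — the printed exponential decay (III.4.8) between points becomes an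
exponential decay between cubes. [cite: Rivasseau1991, §III.4 (III.4.8) p.245] -/
theorem exp_neg_mul_dist_le_cubes {c ℓ : ℝ} (hc : 0 ≤ c) (hℓ : 0 < ℓ) (Δ Δ' : Fin d → ℤ)
    {t y : Fin d → ℝ} (ht : ∀ μ, t μ ∈ Icc (ℓ * (Δ μ : ℝ)) (ℓ * (Δ μ : ℝ) + ℓ))
    (hy : ∀ μ, y μ ∈ Icc (ℓ * (Δ' μ : ℝ)) (ℓ * (Δ' μ : ℝ) + ℓ)) :
    Real.exp (-(c * (ℓ⁻¹ * ‖t - y‖))) ≤ Real.exp c * Real.exp (-(c * supDist d Δ Δ')) := by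
  have hsup := supDist_le_inv_mul_norm_add_one (d := d) hℓ Δ Δ' ht hy
  rw [← Real.exp_add]
  exact Real.exp_le_exp.2 (by nlinarith)

/-- **The hypothesis shape with EXPONENTIAL cube weights, inhabited by dilated profiles** (first variable): for
`C(t,y) = λ^a F(λ(t − y))` with `‖DⁿF(u)‖ ≤ B e^{−c‖u‖}` (`n ≤ p`, `c ≥ 0`), cubes of side `ℓ = λ⁻¹`, `t ∈ Δ`, `y ∈ Δ'`:
`‖Dⁿ_t C(·,y)(t)‖ ≤ (e^{c} B λ^a)·(ℓ⁻¹)ⁿ·e^{−c|Δ − Δ'|_∞}` — the hypothesis `hK` of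
`PauliDeterminant.abs_det_mul_sqrt_prod_factorial_pow_le_pi` with `dec(Δ,Δ') = e^{−c|Δ − Δ'|_∞}` (row sums bounded by
`sum_exp_neg_mul_supDist_le`). [cite: Rivasseau1991, §III.4 (III.4.8) p.245] -/
theorem norm_iteratedFDeriv_dilate_le_cubes_exp {p : ℕ} (F : (Fin d → ℝ) → ℝ) (hF : ContDiff ℝ p F)
    {B c : ℝ} (hc : 0 ≤ c) (hBnn : 0 ≤ B)
    (hB : ∀ n, n ≤ p → ∀ u, ‖iteratedFDeriv ℝ n F u‖ ≤ B * Real.exp (-(c * ‖u‖)))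
    {ℓ : ℝ} (hℓ : 0 < ℓ) (a : ℝ) (Δ Δ' : Fin d → ℤ) {y : Fin d → ℝ}
    (hy : ∀ μ, y μ ∈ Icc (ℓ * (Δ' μ : ℝ)) (ℓ * (Δ' μ : ℝ) + ℓ)) {n : ℕ} (hn : n ≤ p) {t : Fin d → ℝ}
    (ht : ∀ μ, t μ ∈ Icc (ℓ * (Δ μ : ℝ)) (ℓ * (Δ μ : ℝ) + ℓ)) :
    ‖iteratedFDeriv ℝ n (fun t : Fin d → ℝ => ℓ⁻¹ ^ a * F (ℓ⁻¹ • (t - y))) t‖ ≤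
      Real.exp c * B * ℓ⁻¹ ^ a * ℓ⁻¹ ^ n * Real.exp (-(c * supDist d Δ Δ')) := by
  have hlam : 0 < ℓ⁻¹ := inv_pos.2 hℓ
  have h1 := norm_iteratedFDeriv_dilate_exp_le F hF hB hlam a y hn t
  have h2 := exp_neg_mul_dist_le_cubes (d := d) hc hℓ Δ Δ' ht hy
  have hla : 0 ≤ ℓ⁻¹ ^ a := (Real.rpow_pos_of_pos hlam a).le
  calc ‖iteratedFDeriv ℝ n (fun t : Fin d → ℝ => ℓ⁻¹ ^ a * F (ℓ⁻¹ • (t - y))) t‖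
      ≤ ℓ⁻¹ ^ a * B * ℓ⁻¹ ^ n * Real.exp (-(c * (ℓ⁻¹ * ‖t - y‖))) := h1
    _ ≤ ℓ⁻¹ ^ a * B * ℓ⁻¹ ^ n * (Real.exp c * Real.exp (-(c * supDist d Δ Δ'))) :=
        mul_le_mul_of_nonneg_left h2 (by positivity)
    _ = Real.exp c * B * ℓ⁻¹ ^ a * ℓ⁻¹ ^ n * Real.exp (-(c * supDist d Δ Δ')) := by ring

/-- The same for the SECOND variable (`x ↦ C(x₀, x)`, via the reflected profile `u ↦ F(−u)`).
[cite: Rivasseau1991, §III.4 (III.4.8) p.245] -/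
theorem norm_iteratedFDeriv_dilate_le_cubes_exp' {p : ℕ} (F : (Fin d → ℝ) → ℝ) (hF : ContDiff ℝ p F)
    {B c : ℝ} (hc : 0 ≤ c) (hBnn : 0 ≤ B)
    (hB : ∀ n, n ≤ p → ∀ u, ‖iteratedFDeriv ℝ n F u‖ ≤ B * Real.exp (-(c * ‖u‖)))
    {ℓ : ℝ} (hℓ : 0 < ℓ) (a : ℝ) (Δ Δ' : Fin d → ℤ) {x₀ : Fin d → ℝ}
    (hx₀ : ∀ μ, x₀ μ ∈ Icc (ℓ * (Δ' μ : ℝ)) (ℓ * (Δ' μ : ℝ) + ℓ)) {n : ℕ} (hn : n ≤ p) {x : Fin d → ℝ}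
    (hx : ∀ μ, x μ ∈ Icc (ℓ * (Δ μ : ℝ)) (ℓ * (Δ μ : ℝ) + ℓ)) :
    ‖iteratedFDeriv ℝ n (fun x : Fin d → ℝ => ℓ⁻¹ ^ a * F (ℓ⁻¹ • (x₀ - x))) x‖ ≤
      Real.exp c * B * ℓ⁻¹ ^ a * ℓ⁻¹ ^ n * Real.exp (-(c * supDist d Δ Δ')) := by
  set G : (Fin d → ℝ) → ℝ := fun u => F (-u) with hG
  have hGdef : G = F ∘ (LinearIsometryEquiv.neg ℝ (E := Fin d → ℝ)) := by
    funext u; simp [hG]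
  have hGc : ContDiff ℝ p G := by rw [hGdef]; exact hF.comp (LinearIsometryEquiv.neg ℝ).contDiff
  have hGB : ∀ m, m ≤ p → ∀ u, ‖iteratedFDeriv ℝ m G u‖ ≤ B * Real.exp (-(c * ‖u‖)) := by
    intro m hm u
    rw [hGdef, LinearIsometryEquiv.norm_iteratedFDeriv_comp_right]
    have h := hB m hm ((LinearIsometryEquiv.neg ℝ (E := Fin d → ℝ)) u)
    simpa [norm_neg] using h
  have hfun : (fun x : Fin d → ℝ => ℓ⁻¹ ^ a * F (ℓ⁻¹ • (x₀ - x))) =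
      fun x => ℓ⁻¹ ^ a * G (ℓ⁻¹ • (x - x₀)) := by
    funext x; simp only [hG, ← smul_neg, neg_sub]
  rw [hfun]
  exact norm_iteratedFDeriv_dilate_le_cubes_exp G hGc hc hBnn hGB hℓ a Δ Δ' hx₀ hn hx

/-! ### Exponential decay between cubes is summable on `ℤ^d` (the weight `e^{−c|Δ−Δ'|_∞}` as `dec`) -/

open Finset in
/-- One-dimensional geometric row sum: for `0 ≤ q < 1` and any finite `S ⊂ ℤ`, `Σ_{n∈S} q^{|n|} ≤ 2/(1 − q)`
(the two-sided geometric series). [folklore] -/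
private theorem sum_pow_natAbs_le {q : ℝ} (hq0 : 0 ≤ q) (hq1 : q < 1) (S : Finset ℤ) :
    ∑ n ∈ S, q ^ n.natAbs ≤ 2 / (1 - q) := by
  have hg := hasSum_geometric_of_lt_one hq0 hq1
  have hg' : HasSum (fun n : ℕ => q ^ (n + 1)) (q * (1 - q)⁻¹) := by
    simpa [pow_succ', mul_comm] using hg.mul_left q
  have hZ : HasSum (fun n : ℤ => q ^ n.natAbs) ((1 - q)⁻¹ + q * (1 - q)⁻¹) := by
    refine HasSum.of_nat_of_neg_add_one ?_ ?_
    · simpa only [Int.natAbs_natCast] using hg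
    · have h : (fun n : ℕ => q ^ (-((n : ℤ) + 1)).natAbs) = fun n : ℕ => q ^ (n + 1) := by
        funext n
        rw [Int.natAbs_neg, show ((n : ℤ) + 1) = ((n + 1 : ℕ) : ℤ) by push_cast; rfl, Int.natAbs_natCast]
      rw [h]; exact hg'
  have hle := hZ.summable.sum_le_tsum S (fun n _ => pow_nonneg hq0 _)
  rw [hZ.tsum_eq] at hle
  have hpos : 0 < (1 - q)⁻¹ := inv_pos.2 (sub_pos.2 hq1)
  have h2 : (1 - q)⁻¹ + q * (1 - q)⁻¹ ≤ 2 / (1 - q) := by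
    rw [div_eq_mul_inv, ← one_add_mul]
    exact mul_le_mul_of_nonneg_right (by linarith) hpos.le
  exact hle.trans h2

open Finset in
/-- **Exponential cube weights are summable on `ℤ^d`, uniformly in the volume**: for `c > 0`, `d ≥ 1`,
`Σ_{y∈Λ} e^{−c|x − y|_∞} ≤ (2/(1 − e^{−c/d}))^d` — the row-sum bound that lets the exponential decay of
[R] (III.4.8) serve directly as the cube weight `dec` of the Pauli-principle bound.
[cite: Rivasseau1991, §III.4 (III.4.8) p.245; §III.1 (III.1.5) p.149] -/
theorem sum_exp_neg_mul_supDist_le (hd : 0 < d) {c : ℝ} (hc : 0 < c) (x : Fin d → ℤ)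
    (Λ : Finset (Fin d → ℤ)) :
    ∑ y ∈ Λ, Real.exp (-(c * supDist d x y)) ≤ (2 / (1 - Real.exp (-(c / d)))) ^ d := by
  have hdpos : (0 : ℝ) < d := by exact_mod_cast hd
  have ha : 0 < c / d := div_pos hc hdpos
  have hq0 : 0 ≤ Real.exp (-(c / d)) := (Real.exp_pos _).le
  have hq1 : Real.exp (-(c / d)) < 1 := Real.exp_lt_one_iff.2 (by linarith)
  have hg0 : ∀ n : ℤ, 0 ≤ Real.exp (-(c / d)) ^ n.natAbs := fun n => pow_nonneg hq0 _
  have hgexp : ∀ n : ℤ, Real.exp (-(c / d)) ^ n.natAbs = Real.exp (-(c / d * ((n.natAbs : ℕ) : ℝ))) := by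
    intro n
    rw [← Real.exp_nat_mul]; ring_nf
  -- e^{−c sup} = ∏_k e^{−(c/d) sup} ≤ ∏_k e^{−(c/d)|x_k − y_k|}
  have h1 : ∀ y, Real.exp (-(c * supDist d x y)) ≤ ∏ k, Real.exp (-(c / d)) ^ (x k - y k).natAbs := by
    intro y
    have hcoord : ∀ k, (((x k - y k).natAbs : ℕ) : ℝ) ≤ supDist d x y := by
      intro k
      have hk : (x k - y k).natAbs ≤ univ.sup (fun k => (x k - y k).natAbs) :=
        Finset.le_sup (f := fun k => (x k - y k).natAbs) (mem_univ k)
      unfold supDist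
      exact_mod_cast hk
    have hle : ∀ k ∈ (univ : Finset (Fin d)),
        Real.exp (-(c / d * supDist d x y)) ≤ Real.exp (-(c / d)) ^ (x k - y k).natAbs := by
      intro k _
      rw [hgexp]
      exact Real.exp_le_exp.2 (neg_le_neg (mul_le_mul_of_nonneg_left (hcoord k) ha.le))
    have hprod : Real.exp (-(c * supDist d x y)) = ∏ _k : Fin d, Real.exp (-(c / d * supDist d x y)) := by
      rw [prod_const, card_univ, Fintype.card_fin, ← Real.exp_nat_mul]
      congr 1
      field_simp
    rw [hprod]
    exact prod_le_prod (fun k _ => (Real.exp_pos _).le) hle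
  have hinj : Set.InjOn (fun y : Fin d → ℤ => fun k => x k - y k) (Λ : Set (Fin d → ℤ)) := by
    intro y _ y' _ h
    funext k
    have := congr_fun h k
    simp only at this
    linarith
  have h2 : ∑ y ∈ Λ, ∏ k, Real.exp (-(c / d)) ^ (x k - y k).natAbs =
      ∑ z ∈ Λ.image (fun y => fun k => x k - y k), ∏ k, Real.exp (-(c / d)) ^ (z k).natAbs := by
    rw [sum_image hinj]
  have hsub : Λ.image (fun y => fun k => x k - y k) ⊆
      Fintype.piFinset (fun k => Λ.image (fun y => x k - y k)) := by
    intro z hz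
    rw [Fintype.mem_piFinset]
    intro k
    obtain ⟨y, hy, rfl⟩ := mem_image.1 hz
    exact mem_image.2 ⟨y, hy, rfl⟩
  have h3 : ∑ z ∈ Λ.image (fun y => fun k => x k - y k), ∏ k, Real.exp (-(c / d)) ^ (z k).natAbs ≤
      ∑ z ∈ Fintype.piFinset (fun k => Λ.image (fun y => x k - y k)),
        ∏ k, Real.exp (-(c / d)) ^ (z k).natAbs :=
    sum_le_sum_of_subset_of_nonneg hsub (fun z _ _ => prod_nonneg (fun k _ => hg0 _))
  have h4 : ∑ z ∈ Fintype.piFinset (fun k => Λ.image (fun y => x k - y k)),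
        ∏ k, Real.exp (-(c / d)) ^ (z k).natAbs =
      ∏ k, ∑ n ∈ Λ.image (fun y => x k - y k), Real.exp (-(c / d)) ^ n.natAbs :=
    (Finset.prod_univ_sum (fun k => Λ.image (fun y => x k - y k))
      (fun _ n => Real.exp (-(c / d)) ^ n.natAbs)).symm
  have h5 : ∏ k, ∑ n ∈ Λ.image (fun y => x k - y k), Real.exp (-(c / d)) ^ n.natAbs ≤
      ∏ _k : Fin d, (2 / (1 - Real.exp (-(c / d)))) :=
    prod_le_prod (fun k _ => sum_nonneg (fun n _ => hg0 _)) (fun k _ => sum_pow_natAbs_le hq0 hq1 _)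
  have h6 : ∏ _k : Fin d, (2 / (1 - Real.exp (-(c / d)))) = (2 / (1 - Real.exp (-(c / d)))) ^ d := by
    rw [prod_const, card_univ, Fintype.card_fin]
  have h7 : ∑ y ∈ Λ, Real.exp (-(c * supDist d x y)) ≤ ∑ y ∈ Λ, ∏ k, Real.exp (-(c / d)) ^ (x k - y k).natAbs :=
    sum_le_sum (fun y _ => h1 y)
  linarith [h2, h3, h4, h5, h6, h7]

/-! ### The momentum side: a cutoff at scale `λ` is a dilated position-space kernel -/

section FourierSide

open MeasureTheory
open scoped RealInnerProductSpace FourierTransform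

variable {V : Type*} [NormedAddCommGroup V] [InnerProductSpace ℝ V] [MeasurableSpace V] [BorelSpace V]
  [FiniteDimensional ℝ V]

/-- **A momentum cutoff at scale `λ` gives a DILATED position-space kernel**: for any `φ : V → ℂ` and `λ > 0`,
`𝓕(p ↦ φ(λ⁻¹p))(x) = λ^{dim V} · (𝓕φ)(λx)` — so a sliced propagator whose momentum profile is `φ(p/M^i)` (e.g. the
massless case of [R] (III.4.6)–(III.4.7), `C^i(p) = C(p)(e^{−M^{−2i}p²} − e^{−M^{−2(i−1)}p²})` with `C` homogeneous)
is an exact dilate `x ↦ λ^a F(λx)` of the fixed profile `F = 𝓕φ`, the shape consumed by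
`ScaledKernelCubeDecay` ∕ `PauliDeterminantSeveralCubes`. [cite: Rivasseau1991, §III.4 (III.4.6)–(III.4.8) p.245] -/
theorem fourier_comp_inv_smul (φ : V → ℂ) {R : ℝ} (hR : 0 < R) (x : V) :
    𝓕 (fun p : V => φ (R⁻¹ • p)) x = ((R ^ Module.finrank ℝ V : ℝ) : ℂ) * 𝓕 φ (R • x) := by
  rw [Real.fourier_eq, Real.fourier_eq]
  have hR0 : R ≠ 0 := hR.ne'
  -- write the integrand as g (R⁻¹ • p) with g u = 𝐞(−⟪R • u, x⟫) • φ u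
  have hfun' : (fun p : V => 𝐞 (-⟪p, x⟫) • φ (R⁻¹ • p)) =
      fun p : V => (fun u : V => 𝐞 (-⟪R • u, x⟫) • φ u) (R⁻¹ • p) := by
    funext p
    simp only [smul_inv_smul₀ hR0]
  rw [hfun', Measure.integral_comp_smul (μ := volume) (fun u : V => 𝐞 (-⟪R • u, x⟫) • φ u) R⁻¹]
  have habs : |((R⁻¹) ^ Module.finrank ℝ V)⁻¹| = R ^ Module.finrank ℝ V := by
    rw [inv_pow, inv_inv, abs_of_pos (pow_pos hR _)]
  rw [habs]
  have hinner : ∀ u : V, ⟪R • u, x⟫ = ⟪u, R • x⟫ := fun u => by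
    rw [real_inner_smul_left, real_inner_smul_right]
  simp_rw [hinner]
  rw [Complex.real_smul]

/-- **A Schwartz map has the required derivative decay** — any normed domain and codomain (the version of
`schwartz_profile_bound` used for complex-valued momentum profiles): for `f ∈ 𝓢(E, F)` and `p k : ℕ` there is
`B ≥ 0` with `‖Dⁿf(u)‖ ≤ B(1 + ‖u‖)^{−k}` for `n ≤ p`. [cite: Rivasseau1991, §III.1 (III.1.5)–(III.1.6) p.149] -/
theorem schwartz_profile_bound' {E F : Type*} [NormedAddCommGroup E] [NormedSpace ℝ E] [NormedAddCommGroup F]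
    [NormedSpace ℝ F] (f : SchwartzMap E F) (p k : ℕ) :
    ∃ B : ℝ, 0 ≤ B ∧ ∀ n, n ≤ p → ∀ u, ‖iteratedFDeriv ℝ n f u‖ ≤ B * (1 + ‖u‖) ^ (-(k : ℝ)) := by
  refine ⟨2 ^ k * (Finset.Iic (k, p)).sup (fun m => SchwartzMap.seminorm ℝ m.1 m.2) f, by positivity,
    fun n hn u => ?_⟩
  have h := SchwartzMap.one_add_le_sup_seminorm_apply (𝕜 := ℝ) (m := (k, p)) le_rfl hn f u
  have hpos : 0 < (1 + ‖u‖) := by positivity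
  rw [Real.rpow_neg hpos.le, Real.rpow_natCast, ← div_eq_mul_inv, le_div_iff₀ (pow_pos hpos k), mul_comm]
  exact h

/-- Taking the real part does not increase the operator norms of the derivatives (`‖Re‖ = 1`). [folklore] -/
private theorem norm_iteratedFDeriv_re_comp_le {E : Type*} [NormedAddCommGroup E] [NormedSpace ℝ E] {p : ℕ}
    (f : E → ℂ) (hf : ContDiff ℝ p f) {n : ℕ} (hn : n ≤ p) (x : E) :
    ‖iteratedFDeriv ℝ n (fun x => (f x).re) x‖ ≤ ‖iteratedFDeriv ℝ n f x‖ := by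
  have hfun : (fun x => (f x).re) = Complex.reCLM ∘ f := rfl
  rw [hfun, Complex.reCLM.iteratedFDeriv_comp_left (hf.contDiffAt) (by exact_mod_cast hn)]
  refine (ContinuousLinearMap.norm_compContinuousMultilinearMap_le _ _).trans ?_
  rw [Complex.reCLM_norm, one_mul]

/-- **From a momentum-space Schwartz cutoff to a position-space profile with the required bounds.**  For
`φ ∈ 𝓢(ℝ^d, ℂ)` (Euclidean `ℝ^d`), the real profile `F(x) = Re (𝓕φ)(x)` read on `(Fin d → ℝ, ‖·‖_∞)` satisfies,
for all `p k`, `‖DⁿF(x)‖ ≤ B(1 + ‖x‖_∞)^{−k}` for `n ≤ p` — the input of `norm_iteratedFDeriv_dilate_le_cubes`; with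
`fourier_comp_inv_smul` this makes «slice cutoff `φ(p/M^i)` ⟹ kernel `λ^a F(λx)` ⟹ Lemma III.4.1» literal for
Schwartz cutoffs. [cite: Rivasseau1991, §III.4 (III.4.6)–(III.4.8) p.245; §III.1 (III.1.5)–(III.1.6) p.149] -/
theorem exists_profile_bound_re_fourier (φ : SchwartzMap (EuclideanSpace ℝ (Fin d)) ℂ) (p k : ℕ) :
    ∃ B : ℝ, 0 ≤ B ∧ ∀ n, n ≤ p → ∀ x : Fin d → ℝ,
      ‖iteratedFDeriv ℝ n (fun x : Fin d → ℝ =>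
          ((𝓕 (φ : EuclideanSpace ℝ (Fin d) → ℂ)) ((EuclideanSpace.equiv (Fin d) ℝ).symm x)).re) x‖ ≤
        B * (1 + ‖x‖) ^ (-(k : ℝ)) := by
  -- the Schwartz map x ↦ (𝓕φ)(e⁻¹ x) on (Fin d → ℝ)
  set ψ : SchwartzMap (Fin d → ℝ) ℂ :=
    SchwartzMap.compCLMOfContinuousLinearEquiv ℂ (EuclideanSpace.equiv (Fin d) ℝ).symm (𝓕 φ) with hψ
  have hψfun : (ψ : (Fin d → ℝ) → ℂ) =
      fun x => (𝓕 (φ : EuclideanSpace ℝ (Fin d) → ℂ)) ((EuclideanSpace.equiv (Fin d) ℝ).symm x) := by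
    rw [hψ, SchwartzMap.compCLMOfContinuousLinearEquiv_apply]
    rfl
  obtain ⟨B, hB0, hB⟩ := schwartz_profile_bound' ψ p k
  refine ⟨B, hB0, fun n hn x => ?_⟩
  have hre := norm_iteratedFDeriv_re_comp_le (ψ : (Fin d → ℝ) → ℂ) (ψ.smooth p) hn x
  rw [hψfun] at hre
  exact hre.trans (by rw [← hψfun]; exact hB n hn x)

end FourierSide

end ScaledKernel

end Literature.Probability.LatticeModels
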